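import Summits.RiemannHypothesis.RiemannHypothesis.Theorems.TiltedLandingLaw421R3Lens1PinningTol

/-!
# TiltedLandingLaw421R3 — UNION-SHADOW TRICHOTOMY (sign form) for the 2′ residual `RegUmbrellaLowS`

IMAGE «UnionShadow» v1 (tenure rh-tenure-earlyapp-1 g20; director-rh g29 (CA953)(2) «(U) → tenure g20», (CA956)(2) WORD 111 «image it as is
(SIGN FORM)»; landing target `…/Theorems/TiltedLandingLaw421R3UnionShadow.lean`, `--supports stmt-RiemannHypothesis-33346 --as helper`).
SUPPORT, K only: no law is asserted, no new `Prop`-valued definition (only the two real-valued feet); RH is NOT proved; ⟨33346⟩/⟨33347⟩ OPEN.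
ONE import, LANDED: `…R3Lens1PinningTol` (#1256; `…R3Dimple` and `…R3SuccSplit` are in its closure).  Bytes = PREVIEW r0 e44d9af5621567a7
(STATUS l.9416) with this docstring retitled; declarations unchanged.

WHAT (C2 rh-idea-2 g57 PRICE-L memo fa548f4e §3, adopted (CA953)).  On a legal frame, a level-`j` BAND state `T` and any point `b` (the
umbrella partner; NO hypothesis on `b` in the trichotomy) span the UNION SHADOW
`U = [footL T b, footR T b] = [min (Re T − Im T) (Re b − Im b), max (Re T + Im T) (Re b + Im b)]`.
If level `j` is NOT `ReadyR2` (the binder of stub 2′ `RhW08.Lens1PinningTol.RegUmbrellaLowS`, #1256) then — provided both feet of `U` lie in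
the law's range `|· − x₀| < (j+3)·R/2` — one of three things holds:
(i) a TOOTH: a real zero `t ∈ U` of `f⁽ʲ⁾`; (ii) the LEFT-foot dimple sign fails: `0 ≤ Re f⁽ʲ⁺¹⁾ · Re f⁽ʲ⁾` at `footL`;
(iii) the RIGHT-foot dimple sign fails: `Re f⁽ʲ⁺¹⁾ · Re f⁽ʲ⁾ ≤ 0` at `footR`.
★ `unionShadow_trichotomy` is the kernel contrapositive of the tree's `RhIdea3.G35.Landing.readyR2_of_dimple` (…R3Dimple) on the interval `U`
(realness of `f⁽ʲ⁾` on `ℝ` via `Literature.Analysis.Complex.im_iteratedDeriv_ofReal`, exactly as `readyR2_of_dimple_state` does); (ii)/(iii)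
are what C2 reads as «one-sided outside field ≥ 1/h at a foot» (`pair_term_at_edges` / `pair_term_abs_le`: both own pair terms carry the dimple
sign at `U`'s OUTER feet, so a failed sign there is an external field at least as large) — that Γ-decomposition READING is not typed here
((CA956)(2): not required in the kernel; it rides with lens-1's (N′) if the (K) glue ever needs it).
RANGE: `feet_in_range` discharges the range proviso from the band geometry (`RhW08.QuadW.abs_re_sub_le_of_stTrkDQ`: `|Re T − x₀| ≤ R/2 + √j·Hs`,
`Im T ≤ Hs`; partner touching from equal or lower height) under the explicit corner hypothesis `√j·Hs + 3·Hs < (j+2)·R/2`; `corner_of_four_le`: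
the corner is automatic for `j ≥ 4` under `2·Hs ≤ R` (for `j ≤ 3` it stays a hypothesis — the «range corner» C2 prices; not widened, (CA956)(2)).
USE (2′ side, (CA953)(2) order (U) → (N) → (N′) → (K)): 2′'s binders give `¬ ReadyR2 … j v` and a low umbrella partner `b` of the tallest band
state `T` ⇒ `feet_in_range` ⇒ trichotomy ⇒ TOOTH `t ∈ U` (→ lens-1's (N) `ToothNestPure` → `RhW08.SuccB.stTrkDQ_succ_of_nested` with the BAND
parent `T`) ∨ a failed outer-foot sign (the one-sided-field branch; C6's (BAND_k) tabulation counts which branch occurs).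
Nothing here bears on the truth of RH; RH is not proved.
-/

namespace RhW08.UnionShadow

open Complex Set
open Literature.Analysis.Complex
open RhIdea6.G17.W07C7 RhIdea6.G17.W07C7.Rev6 RhIdea6.G18.W07C8.Law421BirthS RhIdea6.G19.W07C11.Seam
open RhW08.Round1 RhW08.StSwap RhW08.Round2 RhW08.QuadW RhW08.SuccB RhW08.SuccSplit RhIdea3.G35.Landing

/-- Left foot of the union shadow of `T` and `b`. -/
noncomputable def footL (T b : ℂ) : ℝ := min (T.re - T.im) (b.re - b.im)

/-- Right foot of the union shadow of `T` and `b`. -/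
noncomputable def footR (T b : ℂ) : ℝ := max (T.re + T.im) (b.re + b.im)

/-- (K) the union shadow contains `T`'s own shadow, hence is a genuine interval when `0 < Im T`. -/
theorem footL_lt_footR {T : ℂ} (b : ℂ) (hT : 0 < T.im) : footL T b < footR T b := by
  unfold footL footR
  have h1 : min (T.re - T.im) (b.re - b.im) ≤ T.re - T.im := min_le_left _ _
  have h2 : T.re + T.im ≤ max (T.re + T.im) (b.re + b.im) := le_max_left _ _
  linarith

/-- ★ (K) UNION-SHADOW TRICHOTOMY, sign form: `¬ ReadyR2` at level `j` + a level-`j` band state `T` + feet of the union shadow with `b`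
inside the range ⇒ tooth in `U` ∨ left-foot sign fails ∨ right-foot sign fails.  (Contrapositive of `readyR2_of_dimple` on `U`.) -/
theorem unionShadow_trichotomy {η : ℝ} {f : ℂ → ℂ} {x₀ s hmax R Hs : ℝ} {B j : ℕ} {T v : ℂ} (b : ℂ)
    (hE : EngineHyps5 2 η f x₀ s hmax R Hs B) (hT : StTrkDQ η f x₀ s hmax R Hs B j T)
    (hnR : ¬ ReadyR2 η f x₀ s hmax R Hs B j v)
    (hrL : |footL T b - x₀| < ((j : ℝ) + 3) * R / 2) (hrR : |footR T b - x₀| < ((j : ℝ) + 3) * R / 2) :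
    (∃ t ∈ Icc (footL T b) (footR T b), iteratedDeriv j f (t : ℂ) = 0) ∨
      0 ≤ (iteratedDeriv (j + 1) f ((footL T b : ℝ) : ℂ)).re * (iteratedDeriv j f ((footL T b : ℝ) : ℂ)).re ∨
      (iteratedDeriv (j + 1) f ((footR T b : ℝ) : ℂ)).re * (iteratedDeriv j f ((footR T b : ℝ) : ℂ)).re ≤ 0 := by
  by_contra h
  push Not at h
  obtain ⟨hnt, hα, hβ⟩ := h
  have hf : Differentiable ℂ f := hE.1
  have hreal : ∀ x : ℝ, (f x).im = 0 := hE.2.1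
  have hTim : 0 < T.im := hT.2.2.1
  exact hnR (readyR2_of_dimple hf η x₀ s hmax R Hs B j v (Literature.Analysis.Complex.im_iteratedDeriv_ofReal hf hreal j)
    (footL_lt_footR b hTim) hrL hrR (fun x hx => hnt x hx) hα hβ)

/-- (K) RANGE OF THE FEET from the band geometry: `T` a level-`j` band state (`|Re T − x₀| ≤ R/2 + √j·Hs`, `Im T ≤ Hs`), `b` disc-touching
`T` from equal or lower height (`|Re T − Re b| ≤ Im T + Im b`, `Im b ≤ Im T`; no sign hypothesis on `Im b` is needed) ⇒ both feet of `U` lie within `R/2 + √j·Hs + 3·Hs` of `x₀`;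
under the explicit corner hypothesis `√j·Hs + 3·Hs < (j+2)·R/2` this is inside the range `(j+3)·R/2`. -/
theorem feet_in_range {η : ℝ} {f : ℂ → ℂ} {x₀ s hmax R Hs : ℝ} {B j : ℕ} {T b : ℂ}
    (hE : EngineHyps5 2 η f x₀ s hmax R Hs B) (hT : StTrkDQ η f x₀ s hmax R Hs B j T)
    (hbT : b.im ≤ T.im) (htouch : |T.re - b.re| ≤ T.im + b.im)
    (hcorner : Real.sqrt j * Hs + 3 * Hs < ((j : ℝ) + 2) * R / 2) :
    |footL T b - x₀| < ((j : ℝ) + 3) * R / 2 ∧ |footR T b - x₀| < ((j : ℝ) + 3) * R / 2 := by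
  have hHs : 0 ≤ Hs := hE.2.2.2.2.2.2.2.1
  have hTHs : T.im ≤ Hs := hT.2.2.2.2
  have hTim : 0 < T.im := hT.2.2.1
  have h1 : |T.re - x₀| ≤ R / 2 + Real.sqrt j * Hs := abs_re_sub_le_of_stTrkDQ hHs hT
  rw [abs_le] at h1
  rw [abs_le] at htouch
  obtain ⟨h1a, h1b⟩ := h1
  obtain ⟨hta, htb⟩ := htouch
  constructor
  · unfold footL
    rw [abs_lt]
    constructor
    · have : x₀ - ((j : ℝ) + 3) * R / 2 < min (T.re - T.im) (b.re - b.im) := by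
        apply lt_min <;> nlinarith
      linarith
    · have : min (T.re - T.im) (b.re - b.im) ≤ T.re - T.im := min_le_left _ _
      nlinarith
  · unfold footR
    rw [abs_lt]
    constructor
    · have : T.re + T.im ≤ max (T.re + T.im) (b.re + b.im) := le_max_left _ _
      nlinarith
    · have : max (T.re + T.im) (b.re + b.im) < x₀ + ((j : ℝ) + 3) * R / 2 := by
        apply max_lt <;> nlinarith
      linarith

/-- (K) the corner hypothesis is automatic from `2·Hs ≤ R` as soon as `√j + 3 ≤ j + 1`, e.g. for every `j ≥ 4` (and for `j = 3`
numerically: `√3 + 3 < 5`); stated here for `4 ≤ j` to stay `nlinarith`-cheap. -/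
theorem corner_of_four_le {R Hs : ℝ} {j : ℕ} (hHs : 0 ≤ Hs) (hR : 2 * Hs ≤ R) (hR0 : 0 < R) (hj : 4 ≤ j) :
    Real.sqrt j * Hs + 3 * Hs < ((j : ℝ) + 2) * R / 2 := by
  have hj' : (4 : ℝ) ≤ (j : ℝ) := by exact_mod_cast hj
  have hsq : Real.sqrt (j : ℝ) ≤ (j : ℝ) / 2 := by
    rw [Real.sqrt_le_left (by positivity)]
    nlinarith
  have h1 : Real.sqrt (j : ℝ) * Hs ≤ (j : ℝ) / 2 * Hs := mul_le_mul_of_nonneg_right hsq hHs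
  nlinarith

end RhW08.UnionShadow
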